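import Summits.ABC.ABC.Theorems.FeketeScalesAssembly
import Summits.ABC.ABC.Theorems.FeketeScalesSubmultOfRST
import Summits.ABC.ABC.Theorems.FeketeScalesPolynomialAbcOfSubmult
import Literature.NumberTheory.DiophantineGeometry.AbcWave0SUnitProofs

/-!
# Crux `ScaleSubmultiplicativity` (stmt-ABC-2160): Fekete's lemma for the abc extremal height

Route `FeketeScales` (ABC/ABC) is named for Fekete's sub-additivity lemma applied to the extremal height
`G(R) := max {c : a + b = c an abc triple, rad(abc) ≤ R}` (a finite maximum by abc.S25 = Mahler 1933, PROVED in
the tree: `finite_setOf_isABCTriple_primeFactors_subset_holds`; `G(R) ≥ 2` for `R ≥ 2` via `(1,1,2)`).  The crux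
(stmt-ABC-2160) is the G-free form of `G(R₁R₂) ≤ K e^{(log R₁R₂)^θ} G(R₁) G(R₂)` (`θ < 1`, `R₁, R₂ ≥ R₀`); the landed
support items use it through `polynomialAbcOfSubmult_proof` (stmt-ABC-2163: `limsup log G/log R < ∞`) and the
Assembly (stmt-ABC-2165: `liminf ≤ 1 ⟹ ABC`).  This file proves the limit statement itself, not yet a kernel fact:

* `ScaleSubmultiplicativity.growthExponent_of_scaleSubmultiplicativity`: under the crux the GROWTH EXPONENT
  `α := lim_{R → ∞} log G(R) / log R` EXISTS (`1 ≤ α < ∞`), stated G-free as (upper) `∀ ε > 0 ∃ C ∀ abc triples,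
  c ≤ C · rad(abc)^{α+ε}` together with (lower) `∀ ε > 0 ∃ N ∀ R ≥ N ∃ abc triple, rad(abc) ≤ R ∧ c ≥ R^{α-ε}`;
* `ScaleSubmultiplicativity.powerLaw_of_not_abc`: hence, under the crux, if abc FAILS it fails by a definite POWER
  LAW at EVERY large radical scale (`α > 1`); equivalently `ABC ⟺ α = 1` (⟺ `SparseGoodScales`) — the crux converts
  the abc conjecture into the value of one real number.

Proof.  Normalise (`FeketeScalesAssembly.submult_normalise`).  ONE-SCALE UPPER PROPAGATION (`upper_of_scale`):
from ANY scale `R ≥ R₀`, `FeketeScalesAssembly.allScales` with base `b = log G(R)` and defect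
`β_R = (L + 2^θ (log R)^θ)/(2 - 2^θ)` plus sublinearity of `N ↦ N^φ` give `c ≤ C_ε rad^{e(R)+ε}` with the ONE-SCALE
EXPONENT `e(R) := (log G(R) + β_R)/log R`.  Put `α := inf_R e(R)`: (upper) take `R` with `e(R) < α + ε/2`; (lower)
`log G(R) = e(R) log R - β_R ≥ α log R - o(log R)` (`beta_le_of_large`), witnessed by the triple attaining `G(R)`;
`α ≥ 1` from the dyadic witnesses (`SubmultOfRST.exists_triple_at_scale`: `R < 4c`, `rad ≤ R`).
Pattern: M. Fekete (1923), Math. Z. 17; de Bruijn–Erdős (1952); Mathlib `Subadditive.tendsto_lim` (not used: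
multiplicative scale, non-constant error term).  A CONSEQUENCE of the crux (`--supports stmt-ABC-2160`), recorded
next to stmt-ABC-2163; it does not bear on the crux's provability (cf. `Cruxes/ScaleSubmultiplicativity/STRATEGY-CENSUS.md`).
-/

-- `Summit.<Summit>.<Problem>` is the mandated summit-side namespace (CONVENTIONS §2); for the
-- single-conjunct summit `ABC` the two coincide, so the duplicate `ABC.ABC` is deliberate.
set_option linter.dupNamespace false

noncomputable section

namespace Summit.ABC.ABC.Theorems

open Literature.NumberTheory.DiophantineGeometry

namespace ScaleSubmultiplicativity.GrowthExponent

/-! ### The extremal height `G(R)` (no new definitions: `G` is produced existentially) -/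

/-- The heights `c` of the abc triples of radical `≤ R` form a bounded set (abc.S25, Mahler 1933, PROVED in the
tree: `finite_setOf_isABCTriple_primeFactors_subset_holds`). [folklore] -/
theorem heights_bddAbove (R : ℕ) : BddAbove {c : ℕ | ∃ a b : ℕ, IsABCTriple a b c ∧ rad a b c ≤ R} := by
  obtain ⟨M, hM⟩ :=
    feketeScales_exists_bound_of_rad_le finite_setOf_isABCTriple_primeFactors_subset_holds R
  exact ⟨M, fun c ⟨a, b, h, hr⟩ => hM a b c h hr⟩

/-- `2` is a height at every scale `R ≥ 2`: the abc triple `(1, 1, 2)`, `rad(1·1·2) = 2`. [folklore] -/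
theorem two_mem_heights {R : ℕ} (hR : 2 ≤ R) :
    (2 : ℕ) ∈ {c : ℕ | ∃ a b : ℕ, IsABCTriple a b c ∧ rad a b c ≤ R} := by
  refine ⟨1, 1, ⟨Nat.one_pos, Nat.one_pos, rfl, Nat.coprime_one_left 1⟩, le_trans (le_of_eq ?_) hR⟩
  rw [rad_def, UniqueFactorizationMonoid.radical_of_prime (Nat.prime_iff.mp Nat.prime_two)]
  simp

/-- **The abc extremal height exists as a function.**  There is `G : ℕ → ℕ` (namely
`G(R) = max {c : abc triple, rad(abc) ≤ R}`, the `sSup` of the bounded set of heights) such that every abc triple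
of radical `≤ R` has `c ≤ G(R)`, and for `R ≥ 2` the value `G(R)` is attained by an abc triple of radical `≤ R`.
[folklore] -/
theorem exists_extremalHeight : ∃ G : ℕ → ℕ,
    (∀ a b c R : ℕ, IsABCTriple a b c → rad a b c ≤ R → c ≤ G R) ∧
    (∀ R : ℕ, 2 ≤ R → ∃ a b : ℕ, IsABCTriple a b (G R) ∧ rad a b (G R) ≤ R) :=
  ⟨fun R => sSup {c : ℕ | ∃ a b : ℕ, IsABCTriple a b c ∧ rad a b c ≤ R},
    fun a b _c R h hr => le_csSup (heights_bddAbove R) ⟨a, b, h, hr⟩,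
    fun R hR => Nat.sSup_mem ⟨2, two_mem_heights hR⟩ (heights_bddAbove R)⟩

/-! ### The one-scale exponent -/

/-- `2^θ < 2` for `θ < 1`. [folklore] -/
theorem two_rpow_lt_two {θ : ℝ} (hθ1 : θ < 1) : (2:ℝ) ^ θ < 2 := by
  have := Real.rpow_lt_rpow_of_exponent_lt (by norm_num : (1:ℝ) < 2) hθ1
  rwa [Real.rpow_one] at this

/-- `β_R = (L + 2^θ (log R)^θ)/(2 - 2^θ) ≥ 0` (for `θ < 1`, `L ≥ 0`, `R ≥ 2`). [folklore] -/
theorem beta_nonneg {θ L : ℝ} (hθ1 : θ < 1) (hL : 0 ≤ L) {R : ℕ} (hR : 2 ≤ R) :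
    0 ≤ (L + (2:ℝ) ^ θ * Real.log R ^ θ) / (2 - (2:ℝ) ^ θ) := by
  have h2 := two_rpow_lt_two hθ1
  have ht : 0 ≤ Real.log R := Real.log_nonneg (by exact_mod_cast le_trans one_le_two hR)
  exact div_nonneg (add_nonneg hL (mul_nonneg (by positivity) (Real.rpow_nonneg ht _))) (by linarith)

/-- The one-scale exponent `e(R) = (log G(R) + β_R)/log R ≥ 0` (for `θ < 1`, `L ≥ 0`, `R ≥ 2`, `G(R) ≥ 1`).
[folklore] -/
theorem expo_nonneg {θ L : ℝ} (hθ1 : θ < 1) (hL : 0 ≤ L) {R g : ℕ} (hR : 2 ≤ R) (hg : 1 ≤ g) :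
    0 ≤ (Real.log g + (L + (2:ℝ) ^ θ * Real.log R ^ θ) / (2 - (2:ℝ) ^ θ)) / Real.log R :=
  div_nonneg (add_nonneg (Real.log_nonneg (by exact_mod_cast hg)) (beta_nonneg hθ1 hL hR))
    (Real.log_nonneg (by exact_mod_cast le_trans one_le_two hR))

/-- **One-scale upper propagation.**  Under the normalised crux (`0 ≤ θ < 1`, slack `e^L e^{(log R₁R₂)^θ}`,
scales `≥ R₀`), from ANY single scale `R ≥ max R₀ 2` every abc triple satisfies `c ≤ C_ε · rad^{e(R) + ε}`:
the Fekete iteration `FeketeScalesAssembly.allScales` with base `b = log G(R)`, `β = β_R`, plus sublinearity of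
`N ↦ γ N^φ`.  Here `G R` is any bound for the heights at scale `R` with `G R ≥ 2` (the extremal height). [folklore] -/
theorem upper_of_scale {θ L : ℝ} {R₀ R : ℕ} {G : ℕ → ℕ} (hθ0 : 0 ≤ θ) (hθ1 : θ < 1) (hL : 0 ≤ L)
    (hsub : ∀ R₁ R₂ : ℕ, R₀ ≤ R₁ → R₀ ≤ R₂ → ∀ a b c : ℕ, IsABCTriple a b c → rad a b c ≤ R₁ * R₂ →
      ∃ a₁ b₁ c₁ a₂ b₂ c₂ : ℕ, IsABCTriple a₁ b₁ c₁ ∧ rad a₁ b₁ c₁ ≤ R₁ ∧ IsABCTriple a₂ b₂ c₂ ∧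
        rad a₂ b₂ c₂ ≤ R₂ ∧
        (c : ℝ) ≤ Real.exp L * Real.exp (Real.log ((R₁ : ℝ) * R₂) ^ θ) * c₁ * c₂)
    (hR₀ : R₀ ≤ R) (hR2 : 2 ≤ R) (hGle : ∀ a b c : ℕ, IsABCTriple a b c → rad a b c ≤ R → c ≤ G R)
    (hG2 : 2 ≤ G R) :
    ∀ ε : ℝ, 0 < ε → ∃ C : ℝ, 0 < C ∧ ∀ a b c : ℕ, IsABCTriple a b c → (c : ℝ) ≤
      C * ((rad a b c : ℕ) : ℝ) ^ ((Real.log (G R) + (L + (2:ℝ) ^ θ * Real.log R ^ θ) / (2 - (2:ℝ) ^ θ)) /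
        Real.log R + ε) := by
  intro ε hε
  have h2θ : (2:ℝ) ^ θ < 2 := two_rpow_lt_two hθ1
  have hR1 : 1 ≤ R := by omega
  have hRpos : (0:ℝ) < R := by positivity
  have hR1' : (1:ℝ) < R := by exact_mod_cast hR2
  set t : ℝ := Real.log R with ht_def
  have htpos : 0 < t := Real.log_pos hR1'
  -- the constants of `allScales`
  have hβ0 := beta_nonneg hθ1 hL hR2 (L := L)
  set β : ℝ := (L + (2:ℝ) ^ θ * Real.log R ^ θ) / (2 - (2:ℝ) ^ θ) with hβ_def
  have hβ : L + (2:ℝ) ^ θ * (Real.log R) ^ θ ≤ β * (2 - (2:ℝ) ^ θ) := by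
    rw [hβ_def, ← ht_def, div_mul_cancel₀ _ (by linarith)]
  set φ : ℝ := (1 + θ) / 2 with hφ
  have hθφ : θ ≤ φ := by rw [hφ]; linarith
  have hφ0 : 0 < φ := by rw [hφ]; linarith
  have hφ1 : φ < 1 := by rw [hφ]; linarith
  have h2φ : (2:ℝ) ^ (-φ) < 1 := Real.rpow_lt_one_of_one_lt_of_neg (by norm_num) (by linarith)
  have htθ : 0 < t ^ θ := Real.rpow_pos_of_pos htpos θ
  set γ : ℝ := (L + t ^ θ) / (1 - (2:ℝ) ^ (-φ)) with hγ_def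
  have hγpos : 0 < γ := div_pos (by linarith) (by linarith)
  have hγ : L + (Real.log R) ^ θ ≤ γ * (1 - (2:ℝ) ^ (-φ)) := by
    rw [← ht_def, hγ_def, div_mul_cancel₀ _ (by linarith)]
  -- the base: `G(R) = exp g`, `g = log G(R)`
  have he0 := expo_nonneg hθ1 hL hR2 (le_trans one_le_two hG2) (L := L)
  have hGpos : (0:ℝ) < (G R : ℝ) := by exact_mod_cast lt_of_lt_of_le two_pos hG2
  set g : ℝ := Real.log (G R : ℝ) with hg_def
  have hexpg : Real.exp g = (G R : ℝ) := by rw [hg_def, Real.exp_log hGpos]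
  -- the iteration, for the predicate "every abc triple with `rad ≤ S` has `c ≤ X`"
  have hall := FeketeScalesAssembly.allScales
    (fun (S : ℕ) (X : ℝ) => ∀ a b c : ℕ, IsABCTriple a b c → rad a b c ≤ S → (c : ℝ) ≤ X)
    (b := g) hθ0 hθφ hL hβ0 hγpos.le hR₀ hR1 hβ hγ
    (fun S X Y hP hXY a b c h1 h2 => (hP a b c h1 h2).trans hXY)
    (by
      intro S₁ S₂ hS₁ hS₂ X₁ X₂ hX₁ hX₂ hP₁ hP₂ a b c habc hrad
      obtain ⟨a₁, b₁, c₁, a₂, b₂, c₂, h₁, hr₁, h₂, hr₂, hc⟩ := hsub S₁ S₂ hS₁ hS₂ a b c habc hrad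
      have hc₁ : (c₁ : ℝ) ≤ X₁ := hP₁ a₁ b₁ c₁ h₁ hr₁
      have hc₂ : (c₂ : ℝ) ≤ X₂ := hP₂ a₂ b₂ c₂ h₂ hr₂
      calc (c : ℝ) ≤ Real.exp L * Real.exp (Real.log ((S₁ : ℝ) * S₂) ^ θ) * c₁ * c₂ := hc
        _ ≤ Real.exp L * Real.exp (Real.log ((S₁ : ℝ) * S₂) ^ θ) * X₁ * X₂ := by gcongr)
    (by
      intro a b c habc hrad
      rw [hexpg]
      exact_mod_cast hGle a b c habc hrad)
  -- sublinearity of `N ↦ γ N^φ`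
  obtain ⟨B₂, hB₂0, hB₂⟩ :=
    FeketeScalesAssembly.rpow_le_linear_add_const hφ0.le hφ1 (a := ε * t / γ) (by positivity)
  set e : ℝ := (g + β) / t with he_def
  have he : e * t = g + β := by rw [he_def, div_mul_cancel₀ _ htpos.ne']
  set B : ℝ := (e + ε) * t + γ * B₂ with hB
  refine ⟨Real.exp B, Real.exp_pos B, ?_⟩
  intro a b c habc
  -- the least `N` with `rad ≤ R ^ N`
  set r : ℕ := rad a b c
  have hr2 : 2 ≤ r := habc.two_le_rad
  set N : ℕ := Nat.clog R r
  have hN1 : 1 ≤ N := Nat.clog_pos hR2 hr2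
  have hrN : r ≤ R ^ N := Nat.le_pow_clog hR2 r
  have hlt : R ^ (N - 1) < r := by
    have := Nat.pow_pred_clog_lt_self hR2 (x := r) hr2
    simpa [Nat.pred_eq_sub_one] using this
  have hc : (c : ℝ) ≤ Real.exp (N * (g + β) + γ * (N : ℝ) ^ φ) := hall N hN1 a b c habc hrN
  -- `N log R < log r + log R`
  have hr0 : 0 < r := by omega
  have hrpos : (0:ℝ) < r := by exact_mod_cast hr0
  set x : ℝ := Real.log r with hx_def
  have hNt : (N : ℝ) * t < x + t := by
    have h1 : ((R : ℝ)) ^ (N - 1) < r := by exact_mod_cast hlt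
    have h2 := Real.log_lt_log (pow_pos hRpos _) h1
    rw [Real.log_pow, Nat.cast_sub hN1] at h2
    push_cast at h2
    rw [← ht_def, ← hx_def] at h2
    linarith
  -- assemble the exponent bound `≤ (e + ε) x + B`
  have hN0 : (0:ℝ) ≤ N := Nat.cast_nonneg N
  have hE1 : (N : ℝ) * (g + β) ≤ e * (x + t) := by
    rw [← he]
    have := mul_le_mul_of_nonneg_right hNt.le he0
    nlinarith [this]
  have hE2 : γ * (N : ℝ) ^ φ ≤ ε * t * N + γ * B₂ := by
    have := mul_le_mul_of_nonneg_left (hB₂ N hN0) hγpos.le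
    have eq : γ * (ε * t / γ * N + B₂) = ε * t * N + γ * B₂ := by field_simp
    linarith
  have hE3 : ε * t * N ≤ ε * (x + t) := by
    have := mul_le_mul_of_nonneg_left hNt.le hε.le
    linarith
  have hE : (N : ℝ) * (g + β) + γ * (N : ℝ) ^ φ ≤ (e + ε) * x + B := by rw [hB]; linarith
  have hexp : Real.exp ((e + ε) * x + B) = Real.exp B * (r : ℝ) ^ (e + ε) := by
    rw [Real.rpow_def_of_pos hrpos, ← Real.exp_add, hx_def]
    congr 1; ring
  calc (c : ℝ) ≤ Real.exp ((e + ε) * x + B) := hc.trans (Real.exp_le_exp.2 hE)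
    _ = Real.exp B * (r : ℝ) ^ (e + ε) := hexp

/-- **`β_R = o(log R)`.**  For every `ε > 0`, `β_R ≤ ε log R` for all large `R` (sublinearity of `t ↦ t^θ`,
`θ < 1`, via `FeketeScalesAssembly.rpow_le_linear_add_const`). [folklore] -/
theorem beta_le_of_large {θ ε : ℝ} (L : ℝ) (hθ0 : 0 ≤ θ) (hθ1 : θ < 1) (hε : 0 < ε) :
    ∃ N : ℕ, ∀ R : ℕ, N ≤ R → (L + (2:ℝ) ^ θ * Real.log R ^ θ) / (2 - (2:ℝ) ^ θ) ≤ ε * Real.log R := by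
  have h2θ := two_rpow_lt_two hθ1
  have h2θpos : 0 < (2:ℝ) ^ θ := by positivity
  set κ : ℝ := ε * (2 - (2:ℝ) ^ θ) with hκ
  have hκ0 : 0 < κ := mul_pos hε (by linarith)
  obtain ⟨B₁, hB₁0, hB₁⟩ :=
    FeketeScalesAssembly.rpow_le_linear_add_const hθ0 hθ1 (a := κ / (2 * (2:ℝ) ^ θ)) (by positivity)
  set T : ℝ := 2 * (L + (2:ℝ) ^ θ * B₁) / κ with hT
  have hstep : ∀ t : ℝ, 0 ≤ t → T ≤ t → L + (2:ℝ) ^ θ * t ^ θ ≤ κ * t := by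
    intro t ht hTt
    have h1 := mul_le_mul_of_nonneg_left (hB₁ t ht) h2θpos.le
    have e : (2:ℝ) ^ θ * (κ / (2 * (2:ℝ) ^ θ) * t + B₁) = κ / 2 * t + (2:ℝ) ^ θ * B₁ := by field_simp
    have hT' : κ / 2 * T = L + (2:ℝ) ^ θ * B₁ := by rw [hT]; field_simp
    have h3 := mul_le_mul_of_nonneg_left hTt (by positivity : (0:ℝ) ≤ κ / 2)
    linarith
  refine ⟨max ⌈Real.exp T⌉₊ 1, fun R hR => ?_⟩
  have hR1 : 1 ≤ R := (le_max_right _ _).trans hR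
  have ht0 : 0 ≤ Real.log R := Real.log_nonneg (by exact_mod_cast hR1)
  have hTt : T ≤ Real.log R := by
    have h1 : Real.exp T ≤ R := (Nat.le_ceil _).trans (by exact_mod_cast (le_max_left _ _).trans hR)
    have := Real.log_le_log (Real.exp_pos T) h1
    rwa [Real.log_exp] at this
  have h := hstep _ ht0 hTt
  rw [div_le_iff₀ (by linarith : (0:ℝ) < 2 - (2:ℝ) ^ θ)]
  calc L + (2:ℝ) ^ θ * Real.log R ^ θ ≤ κ * Real.log R := h
    _ = ε * Real.log R * (2 - (2:ℝ) ^ θ) := by rw [hκ]; ring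

end ScaleSubmultiplicativity.GrowthExponent

open ScaleSubmultiplicativity.GrowthExponent in
/-- **Fekete's lemma for the abc extremal height** (route `FeketeScales`, crux stmt-ABC-2160).
`ScaleSubmultiplicativity` implies that the growth exponent `α = lim_{R→∞} log G(R)/log R` of
`G(R) = max {c : abc triple, rad(abc) ≤ R}` EXISTS, with `1 ≤ α < ∞` — stated G-free: (upper) for every
`ε > 0` some `C` has `c ≤ C · rad(abc)^{α+ε}` for every abc triple, and (lower) for every `ε > 0`, below every
large scale `R` some abc triple has `rad(abc) ≤ R` and `c ≥ R^{α-ε}`.  Here `α = inf_R e(R)` of the one-scale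
exponents (`upper_of_scale`); the lower half is `log G(R) = e(R) log R - β_R ≥ α log R - o(log R)`
(`beta_le_of_large`), witnessed by the triple attaining `G(R)` (`exists_extremalHeight`); `α ≥ 1` by the dyadic witnesses
`(1, 2ⁿ - 1, 2ⁿ)` (`SubmultOfRST.exists_triple_at_scale`).  abc.S25 enters through the PROVED
`finite_setOf_isABCTriple_primeFactors_subset_holds`.  Sharpens `polynomialAbcOfSubmult_proof` (stmt-ABC-2163).
[folklore] -/
theorem ScaleSubmultiplicativity.growthExponent_of_scaleSubmultiplicativity :
    Summit.ABC.ABC.Theses.FeketeScales.ScaleSubmultiplicativity →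
    ∃ α : ℝ, 1 ≤ α ∧
      (∀ ε : ℝ, 0 < ε → ∃ C : ℝ, 0 < C ∧ ∀ a b c : ℕ, IsABCTriple a b c →
        (c : ℝ) ≤ C * ((rad a b c : ℕ) : ℝ) ^ (α + ε)) ∧
      (∀ ε : ℝ, 0 < ε → ∃ N : ℕ, ∀ R : ℕ, N ≤ R →
        ∃ a b c : ℕ, IsABCTriple a b c ∧ rad a b c ≤ R ∧ (R : ℝ) ^ (α - ε) ≤ (c : ℝ)) := by
  rintro ⟨θ, hθ1, K, hK, R₀, h⟩
  -- normalise the crux: `0 ≤ θ'`, slack `e^L`, scales `≥ R₁ = max R₀ 2`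
  have hsub := FeketeScalesAssembly.submult_normalise hK h
  set θ' : ℝ := max θ 0 with hθ'
  set L : ℝ := max (Real.log K) 0 with hL_def
  set R₁ : ℕ := max R₀ 2 with hR₁
  have hθ0 : 0 ≤ θ' := le_max_right _ _
  have hθ1' : θ' < 1 := max_lt hθ1 one_pos
  have hL : 0 ≤ L := le_max_right _ _
  have hR₁2 : 2 ≤ R₁ := le_max_right _ _
  -- the extremal height `G` and `α := inf` of the one-scale exponents `f n = e(R₁ + n)`
  obtain ⟨G, hGle, hGatt⟩ := exists_extremalHeight
  have hG2 : ∀ R : ℕ, 2 ≤ R → 2 ≤ G R := fun R hR => by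
    obtain ⟨a, b, h, hr⟩ := two_mem_heights hR
    exact hGle a b 2 R h hr
  obtain ⟨f, hf⟩ : ∃ f : ℕ → ℝ, ∀ n : ℕ, f n = (Real.log (G (R₁ + n)) +
      (L + (2:ℝ) ^ θ' * Real.log ((R₁ + n : ℕ) : ℝ) ^ θ') / (2 - (2:ℝ) ^ θ')) / Real.log ((R₁ + n : ℕ) : ℝ) :=
    ⟨fun n => _, fun n => rfl⟩
  have hf0 : ∀ n : ℕ, 0 ≤ f n := fun n =>
    (hf n) ▸ expo_nonneg hθ1' hL (by omega) (le_trans one_le_two (hG2 _ (by omega)))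
  have hbdd : BddBelow (Set.range f) := by
    refine ⟨0, ?_⟩
    rintro _ ⟨n, rfl⟩
    exact hf0 n
  obtain ⟨α, hα⟩ : ∃ α : ℝ, α = ⨅ n : ℕ, f n := ⟨_, rfl⟩
  have hαle : ∀ n : ℕ, α ≤ f n := fun n => hα ▸ ciInf_le hbdd n
  have hα0 : 0 ≤ α := hα ▸ le_ciInf hf0
  -- (upper) from a scale whose one-scale exponent is within `ε/2` of `α`
  have hU : ∀ ε : ℝ, 0 < ε → ∃ C : ℝ, 0 < C ∧ ∀ a b c : ℕ, IsABCTriple a b c →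
      (c : ℝ) ≤ C * ((rad a b c : ℕ) : ℝ) ^ (α + ε) := by
    intro ε hε
    have hlt : (⨅ n : ℕ, f n) < α + ε / 2 := by rw [← hα]; linarith
    obtain ⟨n, hn⟩ := exists_lt_of_ciInf_lt hlt
    rw [hf n] at hn
    obtain ⟨C, hC, hCb⟩ := upper_of_scale hθ0 hθ1' hL hsub (Nat.le_add_right R₁ n) (by omega)
      (fun a b c h hr => hGle a b c _ h hr) (hG2 _ (by omega)) (ε / 2) (by linarith)
    refine ⟨C, hC, fun a b c habc => (hCb a b c habc).trans ?_⟩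
    have hr1 : (1:ℝ) ≤ ((rad a b c : ℕ) : ℝ) := by
      exact_mod_cast le_trans one_le_two habc.two_le_rad
    exact mul_le_mul_of_nonneg_left
      (Real.rpow_le_rpow_of_exponent_le hr1 (by linarith)) hC.le
  -- (lower) `log G(R) ≥ α log R - β_R ≥ (α - ε) log R`, witnessed by the triple attaining `G(R)`
  have hLo : ∀ ε : ℝ, 0 < ε → ∃ N : ℕ, ∀ R : ℕ, N ≤ R →
      ∃ a b c : ℕ, IsABCTriple a b c ∧ rad a b c ≤ R ∧ (R : ℝ) ^ (α - ε) ≤ (c : ℝ) := by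
    intro ε hε
    obtain ⟨N, hN⟩ := beta_le_of_large L hθ0 hθ1' hε
    refine ⟨max N R₁, fun R hR => ?_⟩
    have hNR : N ≤ R := (le_max_left _ _).trans hR
    have hR₁R : R₁ ≤ R := (le_max_right _ _).trans hR
    have hR2 : 2 ≤ R := hR₁2.trans hR₁R
    obtain ⟨a, b, hab, hrad⟩ := hGatt R hR2
    refine ⟨a, b, G R, hab, hrad, ?_⟩
    obtain ⟨n, hn⟩ : ∃ n : ℕ, R = R₁ + n := ⟨R - R₁, by omega⟩
    have hαR : α ≤ (Real.log (G R) + (L + (2:ℝ) ^ θ' * Real.log R ^ θ') / (2 - (2:ℝ) ^ θ')) / Real.log R := by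
      have := hαle n
      rw [hf n] at this
      rw [hn]; exact this
    have hRpos : (0:ℝ) < R := by exact_mod_cast (show 0 < R by omega)
    have ht : 0 < Real.log R := Real.log_pos (by exact_mod_cast (show 1 < R by omega))
    have hGpos : (0:ℝ) < (G R : ℝ) := by exact_mod_cast lt_of_lt_of_le two_pos (hG2 R hR2)
    have h1 : α * Real.log R ≤ Real.log (G R) + (L + (2:ℝ) ^ θ' * Real.log R ^ θ') / (2 - (2:ℝ) ^ θ') :=
      (le_div_iff₀ ht).mp hαR
    have h2 := hN R hNR
    have h3 : (α - ε) * Real.log R ≤ Real.log (G R) := by linarith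
    calc (R : ℝ) ^ (α - ε) = Real.exp ((α - ε) * Real.log R) := by
          rw [Real.rpow_def_of_pos hRpos, mul_comm]
      _ ≤ Real.exp (Real.log (G R)) := Real.exp_le_exp.2 h3
      _ = (G R : ℝ) := Real.exp_log hGpos
  -- `1 ≤ α`: an exponent `s < 1` is incompatible with the dyadic witnesses `R < 4c`, `rad ≤ R`
  have h1α : 1 ≤ α := by
    by_contra hlt
    push Not at hlt
    set s : ℝ := (1 + α) / 2 with hs
    have hs0 : 0 < 1 - s := by rw [hs]; linarith
    have hsnn : 0 ≤ s := by rw [hs]; linarith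
    obtain ⟨C, hC, hCb⟩ := hU ((1 - α) / 2) (by linarith)
    have hexp_eq : α + (1 - α) / 2 = s := by rw [hs]; ring
    obtain ⟨M, hM⟩ := exists_nat_ge ((4 * C) ^ (1 / (1 - s)))
    obtain ⟨R, hR⟩ : ∃ R : ℕ, R = max M 4 := ⟨_, rfl⟩
    have hR4 : 4 ≤ R := hR ▸ le_max_right _ _
    have hMR : M ≤ R := hR ▸ le_max_left _ _
    have hRpos : (0:ℝ) < R := by exact_mod_cast (show 0 < R by omega)
    obtain ⟨a, b, c, habc, hrad, hlt4⟩ := SubmultOfRST.exists_triple_at_scale hR4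
    have hc := hCb a b c habc
    rw [hexp_eq] at hc
    have hrad' : ((rad a b c : ℕ) : ℝ) ≤ (R : ℝ) := by exact_mod_cast hrad
    have hcR : (c : ℝ) ≤ C * (R : ℝ) ^ s :=
      hc.trans (mul_le_mul_of_nonneg_left (Real.rpow_le_rpow (Nat.cast_nonneg _) hrad' hsnn) hC.le)
    have hR4c : (R : ℝ) < 4 * c := by exact_mod_cast hlt4
    have hsplit : (R : ℝ) = (R : ℝ) ^ (1 - s) * (R : ℝ) ^ s := by
      rw [← Real.rpow_add hRpos]; norm_num
    have hRM : (4 * C) ^ (1 / (1 - s)) ≤ (R : ℝ) := hM.trans (by exact_mod_cast hMR)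
    have h4C : 4 * C ≤ (R : ℝ) ^ (1 - s) := by
      have := Real.rpow_le_rpow (by positivity) hRM hs0.le
      rwa [one_div, Real.rpow_inv_rpow (by positivity) hs0.ne'] at this
    have hRs : 0 < (R : ℝ) ^ s := Real.rpow_pos_of_pos hRpos s
    have habs : (R : ℝ) < (R : ℝ) :=
      calc (R : ℝ) < 4 * c := hR4c
        _ ≤ 4 * (C * (R : ℝ) ^ s) := by linarith
        _ = (4 * C) * (R : ℝ) ^ s := by ring
        _ ≤ (R : ℝ) ^ (1 - s) * (R : ℝ) ^ s := mul_le_mul_of_nonneg_right h4C hRs.le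
        _ = R := hsplit.symm
    exact lt_irrefl _ habs
  exact ⟨α, h1α, hU, hLo⟩

/-- **Under the crux, a failure of abc is a power law at every scale.**  If `ScaleSubmultiplicativity` holds and
the abc conjecture FAILS, then there is `α > 1` such that below EVERY large radical scale `R` some abc triple has
`rad(abc) ≤ R` and `c ≥ R^{α-ε}` (abc fails with a definite exponent at all large scales, not merely along a
sequence), while `c ≤ C_ε rad^{α+ε}` for all triples.  For: the growth exponent `α ≥ 1` of
`growthExponent_of_scaleSubmultiplicativity` cannot be `1`, since its upper half at `α = 1` is abc itself.
Contrapositive reading: under the crux, `ABC ⟺ α = 1` (⟺ `SparseGoodScales`, cf. `feketeScales_assembly_proof`).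
[folklore] -/
theorem ScaleSubmultiplicativity.powerLaw_of_not_abc :
    Summit.ABC.ABC.Theses.FeketeScales.ScaleSubmultiplicativity → ¬ _root_.ABC →
    ∃ α : ℝ, 1 < α ∧
      (∀ ε : ℝ, 0 < ε → ∃ C : ℝ, 0 < C ∧ ∀ a b c : ℕ, IsABCTriple a b c →
        (c : ℝ) ≤ C * ((rad a b c : ℕ) : ℝ) ^ (α + ε)) ∧
      (∀ ε : ℝ, 0 < ε → ∃ N : ℕ, ∀ R : ℕ, N ≤ R →
        ∃ a b c : ℕ, IsABCTriple a b c ∧ rad a b c ≤ R ∧ (R : ℝ) ^ (α - ε) ≤ (c : ℝ)) := by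
  intro hS hnot
  obtain ⟨α, h1, hU, hLo⟩ := ScaleSubmultiplicativity.growthExponent_of_scaleSubmultiplicativity hS
  refine ⟨α, lt_of_le_of_ne h1 ?_, hU, hLo⟩
  intro h1eq
  apply hnot
  rw [_root_.ABC_iff]
  intro ε hε
  obtain ⟨C, hC, hCb⟩ := hU ε hε
  refine ⟨C + 1, by linarith, fun a b c habc => ?_⟩
  have hpow : 0 < ((rad a b c : ℕ) : ℝ) ^ (1 + ε) :=
    Real.rpow_pos_of_pos (by exact_mod_cast lt_of_lt_of_le two_pos habc.two_le_rad) _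
  calc (c : ℝ) ≤ C * ((rad a b c : ℕ) : ℝ) ^ (α + ε) := hCb a b c habc
    _ = C * ((rad a b c : ℕ) : ℝ) ^ (1 + ε) := by rw [← h1eq]
    _ < (C + 1) * ((rad a b c : ℕ) : ℝ) ^ (1 + ε) := by nlinarith

end Summit.ABC.ABC.Theorems

end
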